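import Summits.HubbardSuperconductivity.HubbardSuperconductivity.Theorems.NodalWardXYDefs

/-!
# `PerturbedXYOrder` (stmt-HubbardSuperconductivity-10739) — line `schwarz-inheritance`, stub `stub_e3BlockBounds`
# (lead c5, exponent-3 tightness: block bounds)

For an angle configuration `θ` on the torus `(ℤ/Lℤ)³` let `j_θ(z) = Σ_i cur (z, i) θ` be the SITE CURRENT (`|j_θ| ≤ 3`),
`(B_n j)(z) = 2^{-3n} Σ_{y ∈ Q_n} j_θ(z + ι y)` its average over the discrete cube `Q_n = {0, …, 2^n - 1}³` attached at `z`
(`ι y = (y_k mod L)_k`), and `S_n(θ) = Σ_z (B_n j)(z)²` the BLOCK ENERGY.  This file proves the three elementary bounds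
used by the exponent-3 tightness chain of the line (`Cruxes/PerturbedXYOrder/Lines/schwarz-inheritance.lean`):

* `S_{n+1} ≤ S_n` — the cube `Q_{n+1}` is the disjoint union of the eight translates `Q_n + 2^n e`, `e ∈ {0,1}³`
  (`y = y' + 2^n e`), so `(B_{n+1} j)(z)` is the MEAN of the eight numbers `(B_n j)(z + 2^n ι e)`; by Cauchy–Schwarz its
  square is at most the mean of their squares, and `Σ_z` of each shifted square is `S_n` (translation invariance);
* `S_n ≤ 9 L³` — `|B_n j| ≤ 3` pointwise and there are `L³` sites;
* `S_n ≥ L³ (3m)²` whenever every bond current is `≥ m ≥ 0` — then `(B_n j)(z) ≥ 3m ≥ 0` pointwise.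

The block manipulations are first proved for an ARBITRARY site function `F : TorusSite 3 L → ℝ` (`bb_blockSum_succ`,
`bb_blockEnergy_succ_le`, `bb_abs_blockAvg_le`, `bb_le_blockAvg`) and then specialised to `F = j_θ`.  Everything is
stated with the block averages written out literally, exactly as in the registered stub (there is no named definition
of `B_n`, `S_n` in the line).
-/

noncomputable section

namespace Summit.HubbardSuperconductivity.HubbardSuperconductivity.Theorems.PerturbedXYOrder

open MeasureTheory Literature.Probability.LatticeModels
open Summit.HubbardSuperconductivity.HubbardSuperconductivity.Theses.NodalWardXY

/-- The discrete cube `Q_n = (Fin (2^n))³` has `2^(3n)` points. -/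
theorem bb_card_cube (n : ℕ) : Fintype.card (Fin 3 → Fin (2 ^ n)) = 2 ^ (3 * n) := by
  rw [Fintype.card_fun, Fintype.card_fin, Fintype.card_fin, ← pow_mul, mul_comm]

/-- **Dyadic splitting of a block sum.**  For any site function `F`, the sum of `F` over the cube `z + ι Q_{n+1}` is the
sum over `e ∈ {0,1}³` of the sums over the eight sub-cubes `z + 2^n ι e + ι Q_n`: every `y ∈ Q_{n+1}` is uniquely
`y' + 2^n e` with `y' ∈ Q_n`, `e ∈ {0,1}³` (coordinatewise `Fin 2 × Fin (2^n) ≃ Fin (2 · 2^n)`), and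
`ι(y' + 2^n e) = 2^n ι e + ι y'` in `(ℤ/Lℤ)³`. -/
theorem bb_blockSum_succ {L : ℕ} (F : TorusSite 3 L → ℝ) (z : TorusSite 3 L) (n : ℕ) :
    ∑ y : Fin 3 → Fin (2 ^ (n + 1)), F (z + fun k => ((y k : ℕ) : ZMod L)) =
      ∑ e : Fin 3 → Fin 2, ∑ y : Fin 3 → Fin (2 ^ n),
        F ((z + fun k => ((2 ^ n * (e k : ℕ) : ℕ) : ZMod L)) + fun k => ((y k : ℕ) : ZMod L)) := by
  -- the coordinatewise equivalence `(e, y') ↦ y' + 2^n e`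
  let Φ : (Fin 3 → Fin 2) × (Fin 3 → Fin (2 ^ n)) ≃ (Fin 3 → Fin (2 ^ (n + 1))) :=
    (Equiv.arrowProdEquivProdArrow (Fin 3) (fun _ => Fin 2) (fun _ => Fin (2 ^ n))).symm.trans
      (Equiv.piCongrRight fun _ => finProdFinEquiv.trans (finCongr (pow_succ' 2 n).symm))
  have hΦ : ∀ (p : (Fin 3 → Fin 2) × (Fin 3 → Fin (2 ^ n))) (k : Fin 3),
      ((Φ p k : ℕ) : ZMod L) = ((2 ^ n * (p.1 k : ℕ) : ℕ) : ZMod L) + ((p.2 k : ℕ) : ZMod L) := by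
    intro p k
    have hval : (Φ p k : ℕ) = (p.2 k : ℕ) + 2 ^ n * (p.1 k : ℕ) := by
      simp [Φ]
    rw [hval]
    push_cast
    ring
  calc ∑ y : Fin 3 → Fin (2 ^ (n + 1)), F (z + fun k => ((y k : ℕ) : ZMod L))
      = ∑ p : (Fin 3 → Fin 2) × (Fin 3 → Fin (2 ^ n)),
          F ((z + fun k => ((2 ^ n * (p.1 k : ℕ) : ℕ) : ZMod L)) + fun k => ((p.2 k : ℕ) : ZMod L)) := by
        refine (Fintype.sum_equiv Φ _ _ fun p => ?_).symm
        congr 1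
        funext k
        simp only [Pi.add_apply, hΦ]
        ring
    _ = _ := Fintype.sum_prod_type _

/-- **Monotonicity of block energies, `S_{n+1} ≤ S_n`**, for an arbitrary site function `F`.  By `bb_blockSum_succ` and
`2^(3(n+1)) = 8 · 2^(3n)`, the `(n+1)`-block average at `z` is the mean of the eight `n`-block averages at the shifted
sites `z + 2^n ι e`; Cauchy–Schwarz (`sq_sum_le_card_mul_sum_sq`) bounds its square by the mean of their squares, and for
each fixed shift `c`, `Σ_z` of the shifted squares equals `Σ_z` of the unshifted ones (`z ↦ z + c` is a bijection). -/
theorem bb_blockEnergy_succ_le (L : ℕ) [NeZero L] (F : TorusSite 3 L → ℝ) (n : ℕ) :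
    ∑ z : TorusSite 3 L, ((∑ y : Fin 3 → Fin (2 ^ (n + 1)), F (z + fun k => ((y k : ℕ) : ZMod L))) /
        (2 : ℝ) ^ (3 * (n + 1))) ^ 2 ≤
      ∑ z : TorusSite 3 L, ((∑ y : Fin 3 → Fin (2 ^ n), F (z + fun k => ((y k : ℕ) : ZMod L))) /
        (2 : ℝ) ^ (3 * n)) ^ 2 := by
  -- fold the `n`-block sum into an opaque site function `B` with defining equation `hB`
  obtain ⟨B, hB⟩ : ∃ B : TorusSite 3 L → ℝ,
      ∀ x, ∑ y : Fin 3 → Fin (2 ^ n), F (x + fun k => ((y k : ℕ) : ZMod L)) = B x := ⟨_, fun x => rfl⟩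
  set N : ℝ := (2 : ℝ) ^ (3 * n) with hN
  have hpow : (2 : ℝ) ^ (3 * (n + 1)) = N * 8 := by
    rw [hN, show 3 * (n + 1) = 3 * n + 3 by ring, pow_add]
    norm_num
  have hcard8 : (Finset.univ : Finset (Fin 3 → Fin 2)).card = 8 := by simp
  -- pointwise: Jensen / Cauchy–Schwarz for the mean of eight numbers
  have hpt : ∀ z : TorusSite 3 L,
      ((∑ y : Fin 3 → Fin (2 ^ (n + 1)), F (z + fun k => ((y k : ℕ) : ZMod L))) / (2 : ℝ) ^ (3 * (n + 1))) ^ 2 ≤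
        (∑ e : Fin 3 → Fin 2, (B (z + fun k => ((2 ^ n * (e k : ℕ) : ℕ) : ZMod L)) / N) ^ 2) / 8 := by
    intro z
    rw [bb_blockSum_succ F z n, hpow]
    simp only [hB]
    have hmean : (∑ e : Fin 3 → Fin 2, B (z + fun k => ((2 ^ n * (e k : ℕ) : ℕ) : ZMod L))) / (N * 8) =
        (∑ e : Fin 3 → Fin 2, B (z + fun k => ((2 ^ n * (e k : ℕ) : ℕ) : ZMod L)) / N) / 8 := by
      rw [← Finset.sum_div, div_div]
    have hcs := sq_sum_le_card_mul_sum_sq (s := (Finset.univ : Finset (Fin 3 → Fin 2)))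
      (f := fun e => B (z + fun k => ((2 ^ n * (e k : ℕ) : ℕ) : ZMod L)) / N)
    simp only [hcard8, Nat.cast_ofNat] at hcs
    rw [hmean]
    calc ((∑ e : Fin 3 → Fin 2, B (z + fun k => ((2 ^ n * (e k : ℕ) : ℕ) : ZMod L)) / N) / 8) ^ 2
        = (∑ e : Fin 3 → Fin 2, B (z + fun k => ((2 ^ n * (e k : ℕ) : ℕ) : ZMod L)) / N) ^ 2 / 64 := by ring
      _ ≤ (8 * ∑ e : Fin 3 → Fin 2, (B (z + fun k => ((2 ^ n * (e k : ℕ) : ℕ) : ZMod L)) / N) ^ 2) / 64 := by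
          gcongr
      _ = _ := by ring
  -- sum over `z`, exchange the two sums, use translation invariance of `Σ_z`
  simp only [hB]
  calc ∑ z : TorusSite 3 L,
        ((∑ y : Fin 3 → Fin (2 ^ (n + 1)), F (z + fun k => ((y k : ℕ) : ZMod L))) / (2 : ℝ) ^ (3 * (n + 1))) ^ 2
      ≤ ∑ z : TorusSite 3 L,
          (∑ e : Fin 3 → Fin 2, (B (z + fun k => ((2 ^ n * (e k : ℕ) : ℕ) : ZMod L)) / N) ^ 2) / 8 :=
        Finset.sum_le_sum fun z _ => hpt z
    _ = (∑ e : Fin 3 → Fin 2, ∑ z : TorusSite 3 L,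
          (B (z + fun k => ((2 ^ n * (e k : ℕ) : ℕ) : ZMod L)) / N) ^ 2) / 8 := by
        rw [← Finset.sum_div, Finset.sum_comm]
    _ = (∑ _e : Fin 3 → Fin 2, ∑ z : TorusSite 3 L, (B z / N) ^ 2) / 8 := by
        congr 1
        refine Finset.sum_congr rfl fun e _ => ?_
        exact Fintype.sum_equiv (Equiv.addRight (fun k => ((2 ^ n * (e k : ℕ) : ℕ) : ZMod L))) _ _
          fun z => by simp
    _ = ∑ z : TorusSite 3 L, (B z / N) ^ 2 := by
        rw [Finset.sum_const, hcard8, nsmul_eq_mul]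
        push_cast
        ring

/-- A block average of a site function bounded by `M` in absolute value is bounded by `M` in absolute value. -/
theorem bb_abs_blockAvg_le {L : ℕ} (F : TorusSite 3 L → ℝ) (M : ℝ) (hF : ∀ x, |F x| ≤ M)
    (z : TorusSite 3 L) (n : ℕ) :
    |(∑ y : Fin 3 → Fin (2 ^ n), F (z + fun k => ((y k : ℕ) : ZMod L))) / (2 : ℝ) ^ (3 * n)| ≤ M := by
  rw [abs_div, abs_of_pos (by positivity : (0 : ℝ) < (2 : ℝ) ^ (3 * n)), div_le_iff₀ (by positivity)]
  calc |∑ y : Fin 3 → Fin (2 ^ n), F (z + fun k => ((y k : ℕ) : ZMod L))|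
      ≤ ∑ y : Fin 3 → Fin (2 ^ n), |F (z + fun k => ((y k : ℕ) : ZMod L))| := Finset.abs_sum_le_sum_abs _ _
    _ ≤ ∑ _y : Fin 3 → Fin (2 ^ n), M := Finset.sum_le_sum fun y _ => hF _
    _ = M * (2 : ℝ) ^ (3 * n) := by
        rw [Finset.sum_const, Finset.card_univ, bb_card_cube, nsmul_eq_mul]
        push_cast
        ring

/-- A block average of a site function bounded below by `M` is bounded below by `M`. -/
theorem bb_le_blockAvg {L : ℕ} (F : TorusSite 3 L → ℝ) (M : ℝ) (hF : ∀ x, M ≤ F x)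
    (z : TorusSite 3 L) (n : ℕ) :
    M ≤ (∑ y : Fin 3 → Fin (2 ^ n), F (z + fun k => ((y k : ℕ) : ZMod L))) / (2 : ℝ) ^ (3 * n) := by
  rw [le_div_iff₀ (by positivity)]
  calc M * (2 : ℝ) ^ (3 * n) = ∑ _y : Fin 3 → Fin (2 ^ n), M := by
        rw [Finset.sum_const, Finset.card_univ, bb_card_cube, nsmul_eq_mul]
        push_cast
        ring
    _ ≤ ∑ y : Fin 3 → Fin (2 ^ n), F (z + fun k => ((y k : ℕ) : ZMod L)) := Finset.sum_le_sum fun y _ => hF _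

/-- **Block bounds** (stub `stub_e3BlockBounds` of the line `schwarz-inheritance`, exponent-3 tightness).  With
`j_θ(z) = Σ_i cur (z, i) θ`, `(B_n j)(z) = 2^{-3n} Σ_{y ∈ Q_n} j_θ(z + ι y)` and `S_n = Σ_z (B_n j)(z)²`:
`S_{n+1} ≤ S_n` (a `2^(n+1)`-block average is the mean of eight `2^n`-block averages; Jensen + translation invariance of
`Σ_z`, `bb_blockEnergy_succ_le`), `S_n ≤ 9L³` (`|j_θ| ≤ 3` since `|sin| ≤ 1`, `bb_abs_blockAvg_le`), and `S_n ≥ L³(3m)²`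
when every bond current is `≥ m ≥ 0` (`j_θ ≥ 3m ≥ 0`, `bb_le_blockAvg`). -/
theorem stub_e3BlockBounds (L : ℕ) [NeZero L] (θ : TorusSite 3 L → ℝ) (n : ℕ) :
    (∑ z : TorusSite 3 L, ((∑ y : Fin 3 → Fin (2 ^ (n + 1)), ∑ i : Fin 3, cur (z + (fun k => ((y k : ℕ) : ZMod L)), i) θ) / (2 : ℝ) ^ (3 * (n + 1))) ^ 2) ≤
      (∑ z : TorusSite 3 L, ((∑ y : Fin 3 → Fin (2 ^ n), ∑ i : Fin 3, cur (z + (fun k => ((y k : ℕ) : ZMod L)), i) θ) / (2 : ℝ) ^ (3 * n)) ^ 2) ∧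
    (∑ z : TorusSite 3 L, ((∑ y : Fin 3 → Fin (2 ^ n), ∑ i : Fin 3, cur (z + (fun k => ((y k : ℕ) : ZMod L)), i) θ) / (2 : ℝ) ^ (3 * n)) ^ 2) ≤ 9 * (L : ℝ) ^ 3 ∧
    (∀ m : ℝ, 0 ≤ m → (∀ b : Bond L, m ≤ cur b θ) →
      (L : ℝ) ^ 3 * (3 * m) ^ 2 ≤ (∑ z : TorusSite 3 L, ((∑ y : Fin 3 → Fin (2 ^ n), ∑ i : Fin 3, cur (z + (fun k => ((y k : ℕ) : ZMod L)), i) θ) / (2 : ℝ) ^ (3 * n)) ^ 2)) := by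
  -- the site current `j_θ` as an opaque site function `F` with defining equation `hF`
  obtain ⟨F, hF⟩ : ∃ F : TorusSite 3 L → ℝ, ∀ x, ∑ i : Fin 3, cur (x, i) θ = F x := ⟨_, fun x => rfl⟩
  simp only [hF]
  -- `|j_θ| ≤ 3`
  have hF3 : ∀ x, |F x| ≤ 3 := by
    intro x
    rw [← hF]
    calc |∑ i : Fin 3, cur (x, i) θ| ≤ ∑ i : Fin 3, |cur (x, i) θ| := Finset.abs_sum_le_sum_abs _ _
      _ ≤ ∑ _i : Fin 3, (1 : ℝ) := Finset.sum_le_sum fun i _ => Real.abs_sin_le_one _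
      _ = 3 := by simp
  -- `L³` sites
  have hLT : (Finset.univ : Finset (TorusSite 3 L)).card = L ^ 3 := by
    rw [Finset.card_univ, Fintype.card_fun, ZMod.card, Fintype.card_fin]
  refine ⟨bb_blockEnergy_succ_le L F n, ?_, fun m hm hcur => ?_⟩
  · -- upper bound `S_n ≤ 9 L³`
    calc ∑ z : TorusSite 3 L, ((∑ y : Fin 3 → Fin (2 ^ n), F (z + fun k => ((y k : ℕ) : ZMod L))) /
            (2 : ℝ) ^ (3 * n)) ^ 2
        ≤ ∑ _z : TorusSite 3 L, (9 : ℝ) := by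
          refine Finset.sum_le_sum fun z _ => ?_
          have h := bb_abs_blockAvg_le F 3 hF3 z n
          rw [← sq_abs]
          nlinarith [abs_nonneg ((∑ y : Fin 3 → Fin (2 ^ n), F (z + fun k => ((y k : ℕ) : ZMod L))) /
            (2 : ℝ) ^ (3 * n))]
      _ = 9 * (L : ℝ) ^ 3 := by
          rw [Finset.sum_const, hLT, nsmul_eq_mul]
          push_cast
          ring
  · -- lower bound `S_n ≥ L³ (3m)²` when all currents are `≥ m ≥ 0`
    have hFm : ∀ x, 3 * m ≤ F x := by
      intro x
      rw [← hF]
      calc 3 * m = ∑ _i : Fin 3, m := by simp [mul_comm]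
        _ ≤ ∑ i : Fin 3, cur (x, i) θ := Finset.sum_le_sum fun i _ => hcur (x, i)
    calc (L : ℝ) ^ 3 * (3 * m) ^ 2 = ∑ _z : TorusSite 3 L, (3 * m) ^ 2 := by
          rw [Finset.sum_const, hLT, nsmul_eq_mul]
          push_cast
          ring
      _ ≤ ∑ z : TorusSite 3 L, ((∑ y : Fin 3 → Fin (2 ^ n), F (z + fun k => ((y k : ℕ) : ZMod L))) /
            (2 : ℝ) ^ (3 * n)) ^ 2 := by
          refine Finset.sum_le_sum fun z _ => ?_
          exact pow_le_pow_left₀ (by linarith) (bb_le_blockAvg F (3 * m) hFm z n) 2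

end Summit.HubbardSuperconductivity.HubbardSuperconductivity.Theorems.PerturbedXYOrder

end
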